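import Literature.AlgebraicGeometry.HodgeTheory.HodgeConjecture
import HarnessLib

/-!
# Reduction of the Hodge conjecture to middle-dimensional classes on even-dimensional varieties

A named fact (D-0014: `def … : Prop`, users take `(h : middleDimensionReduction)`) recording the
standard reduction, as printed in

* P. Brosnan, H. Fang, Z. Nie, G. Pearlstein, *Singularities of admissible normal functions*,
  Invent. Math. 177 (2009), §6, **Lemma 48** (arXiv:0711.0964, p. 13): "The following two statements
  are equivalent: • The Hodge conjecture holds for all smooth projective complex varieties `Y`.
  • For every smooth projective complex variety `X` of dimension `2n` with `n ∈ ℤ`, `(Alg^n X)^⊥ = 0`."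
  together with the sentence preceding it (p. 13): "By Poincaré duality and the Hodge–Riemann
  bilinear relations, the cup product … restricts to give a perfect pairing
  `Hdg^k Y ⊗ Hdg^{dim Y − k} Y → ℚ`. Therefore, the Hodge conjecture for `Y` is equivalent to the
  assertion that the perpendicular subspace `(Alg^k Y)^⊥ ⊂ Hdg^{dim Y − k} Y` is zero" — so that the
  second bullet is literally "every rational middle-degree Hodge class on every even-dimensional
  smooth projective `X` is algebraic". Proof in print (p. 13): for `dim Y < 2k` pass to
  `X = Y × ℙ^{2k − dim Y}` (`pr₁^*` injective, projection formula); for `dim Y > 2k` cut `Y` by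
  `dim Y − 2k` general hyperplanes (Bertini) to a smooth `X^{2k}` (weak Lefschetz: `i^*` injective on
  `H^{2k}`, projection formula).
* R. Thomas, *Nodes and the Hodge conjecture*, J. Algebraic Geom. 14 (2005), **Proposition 2**
  (arXiv:math/0212216, p. 4): the same reduction in its effective form ("there exist integers
  `N₁ ≠ 0, N₂` and an effective algebraic cycle `Z ⊂ X` whose fundamental class equals
  `N₁ A + N₂ ωⁿ`"), proved by hard Lefschetz for `k > d/2` and by a pencil / countability induction on
  `d` for `k < d/2`; Remark 1 there (Totaro) for the weight argument on resolutions.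

Only the non-trivial direction (middle degree on even-dimensional varieties ⇒ all degrees on all
varieties) is recorded; the converse is a specialisation. The statement is about the CYCLE part of
`HodgeConjectureFor` (membership of rational `(p,p)`-classes in `algebraicClasses X p =
Nᵖ H²ᵖ(X(ℂ); ℂ)`); the conjunct `Nonempty (HodgeModel n X)` of `HodgeConjectureFor` is the separate
fact `nonempty_hodgeModel` (file `HodgeModelExistence`). Vocabulary: the tree's
`Motives.IsSmoothProjective`, `complexBetti`, `IsRationalClass`, `IsOfHodgeType`, `algebraicClasses`
(files `AlgebraicClasses`, `RationalHodgeClasses`, `HodgeConjecture`); nothing is redefined.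

Grounds the assembly `Summit.HodgeConjecture.HodgeConjecture.Theses.HeightMassDefect.Assembly`
(`SectionRestriction → HodgeConjecture`: Kerr–Pearlstein 2011 Thm 42 / BFNP Thm 52 prove
"restriction ⇒ middle-degree classes algebraic" by induction on the even dimension, and conclude by
this reduction) and the support `….HeightMassDefect.FourfoldCriterion` (where it is NOT needed:
dimension `4` is handled degree by degree).

Mathlib / tree search (2026-08-15): `lean search 'Lemma 48|Thomas2005|middleDimension|BFNP'` — no
prior statement; the Hodge vocabulary is the tree's (`HodgeConjecture.lean`).
-/

noncomputable section

namespace Literature.AlgebraicGeometry.HodgeTheory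

/-- **Reduction to the middle dimension** (Brosnan–Fang–Nie–Pearlstein 2009, Lemma 48, read through
the perfect pairing `Hdg^k ⊗ Hdg^{dim−k} → ℚ` stated just before it; Thomas 2005, Prop. 2 for the
effective variant): if for every smooth projective complex variety `X` of even dimension `2m` every
rational Hodge class of type `(m,m)` in `H^{2m}(X(ℂ); ℂ)` is algebraic (a `ℂ`-linear — equivalently
`ℚ`-linear — combination of classes of codimension-`m` algebraic cycles, i.e. lies in
`algebraicClasses X m`), then for every smooth projective complex variety `X` of any dimension `n`
and every `p`, every rational `(p,p)`-class in `H^{2p}(X(ℂ); ℂ)` lies in `algebraicClasses X p`.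
(Printed proof: products with projective spaces when `n < 2p`; smooth complete intersections of
`n − 2p` general hyperplanes, weak Lefschetz and the projection formula when `n > 2p`.)
[cite: BrosnanFangNiePearlstein2009, Lemma 48] -/
def middleDimensionReduction : Prop :=
  (∀ ⦃m : ℕ⦄ ⦃X : Motives.SchemeOver ℂ⦄, Motives.IsSmoothProjective (2 * m) X →
      ∀ c : complexBetti X (2 * m), IsRationalClass c → IsOfHodgeType (2 * m) X (2 * m) m m c →
        c ∈ algebraicClasses X m) →
    ∀ ⦃n : ℕ⦄ ⦃X : Motives.SchemeOver ℂ⦄, Motives.IsSmoothProjective n X →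
      ∀ (p : ℕ) (c : complexBetti X (2 * p)), IsRationalClass c → IsOfHodgeType n X (2 * p) p p c →
        c ∈ algebraicClasses X p

/-- With the reduction and the existence of Hodge models, the middle-dimensional statement gives the
full `HodgeConjectureFor n X` for every smooth projective `X` (sanity: the fact plugs into the tree's
statement). [cite: BrosnanFangNiePearlstein2009, Lemma 48] -/
theorem hodgeConjectureFor_of_middleDimension (h : middleDimensionReduction)
    (hmodel : ∀ ⦃n : ℕ⦄ ⦃X : Motives.SchemeOver ℂ⦄, Motives.IsSmoothProjective n X → Nonempty (HodgeModel n X))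
    (hmid : ∀ ⦃m : ℕ⦄ ⦃X : Motives.SchemeOver ℂ⦄, Motives.IsSmoothProjective (2 * m) X →
      ∀ c : complexBetti X (2 * m), IsRationalClass c → IsOfHodgeType (2 * m) X (2 * m) m m c →
        c ∈ algebraicClasses X m)
    {n : ℕ} {X : Motives.SchemeOver ℂ} (hX : Motives.IsSmoothProjective n X) :
    HodgeConjectureFor n X :=
  ⟨hmodel hX, fun p c hc hpp => h hmid hX p c hc hpp⟩

end Literature.AlgebraicGeometry.HodgeTheory

end
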